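import Summits.Ventures.CertifiedManyBodySolver.Upper.UMPSDualBoundBridge

/-!
# uMPS with a conserved charge: the one-site insertion formula and the charge identity `Y_N = P̂ + Q − Φ(P̂)`

HONEST FRAMING: first certified bounds; not a superconductivity verdict; every number certified or
labelled float.

Venture `Ventures/CertifiedManyBodySolver` (sr-mbsolver), K1-GATE «writer (ii)» piece (γ) of the route pen's
`WRITER-II-SPEC.md` (sr-mbsolver-var-7): the k-FREE particle-number defect of the boundary-propagated uMPS
mixtures built from a `U(1)`-blocked tensor. In the vocabulary of `Upper/UMPSDualBound.lean` (left-isometric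
`A : Fin q → M_D(ℂ)`, transfer operator `𝔼`, Heisenberg map `Φ`, open vectors `ψ_a = mpsOpen N A e_a r`):

* `siteImage A M = Σ_{s s'} M_{s s'} (A s)ᴴ (A s')` — the one-site analogue of `bondImage`;
  `sum_star_mpsOpen_dotProduct_onSite_mulVec` — **one-site insertion**
  `Σ_a ⟨ψ_a, M_j ψ_a⟩ = Tr(𝔼^{N−1−j}(r r†) · Y_M)`;
* the BLOCK STRUCTURE of a `U(1)`-symmetric tensor as a charge rule on entries: integer bond labels
  `lab : Fin D → ℤ`, site charges `nS : Fin q → ℤ`, a reference (cell) charge `Q`, and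
  `A s α β ≠ 0 → lab β + Q = lab α + nS s` (exactly the producers' rule "out-sector = in-sector + c(s) − ν",
  eng-1 `FORMAT-bdstrip-cell-v1`, with `Σ ν = Q` folded into one site);
* **`siteImage_charge_eq`** — the charge identity `Y_N = P̂ + Q·1 − Φ(P̂)` for the label operator
  `P̂ = diagonal lab` and `N = diagonal nS` (left isometry used once);
* **`sum_star_mpsOpen_dotProduct_sum_onSite_charge_eq`** — telescoped over the `N` sites:
  `Σ_a ⟨ψ_a, (Σ_j N_j) ψ_a⟩ = N·Q·‖r‖² + Tr(r r† P̂) − Tr(𝔼^N(r r†) P̂)`;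
* `re_sum_star_mpsOpen_dotProduct_sum_onSite_charge_mem` — with `qmin ≤ lab ≤ qmax` and `‖r‖ = 1`, the mean
  particle number of the mixture lies in `N·Q ± (qmax − qmin)`: the k-free defect `q` of the GC consumer
  (`Theorems.m3Upper_tp0_le_m18o25_of_columnMajorSpinFamily`, number clauses).

Pure linear algebra; no claim about the Hubbard model. References: route pen's `WRITER-II-SPEC.md` §1 (γ);
M. Fannes, B. Nachtergaele, R. F. Werner, Comm. Math. Phys. 144 (1992) 443 (expectations in finitely
correlated states via `𝔼`); the charge bookkeeping is the standard `U(1)`-symmetric MPS block rule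
(e.g. Singh–Pfeifer–Vidal, Phys. Rev. B 83 (2011) 115125, §III), here as an elementary entrywise identity.
-/

noncomputable section

open Matrix Finset
open scoped ComplexOrder BigOperators

namespace Summit.Ventures.CertifiedManyBodySolver.Upper

open Literature.MathematicalPhysics.QuantumLattice Literature.LinearAlgebra.Matrix

variable {q D : ℕ}

/-! ### The one-site insertion formula -/

/-- The one-site image `Y_M = Σ_{s s'} M_{s s'} (A s)ᴴ (A s')` of a one-site matrix `M`
("`M` pushed onto the bond space"; the one-site analogue of `bondImage`). -/
def siteImage (A : MPSTensor q D) (M : Matrix (Fin q) (Fin q) ℂ) : Matrix (Fin D) (Fin D) ℂ :=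
  ∑ s : Fin q, ∑ s' : Fin q, M s s' • ((A s)ᴴ * A s')

/-- The one-site image of a diagonal matrix: `Y_{diag d} = Σ_s d_s (A s)ᴴ (A s)`. -/
theorem siteImage_diagonal (A : MPSTensor q D) (d : Fin q → ℂ) :
    siteImage A (diagonal d) = ∑ s, d s • ((A s)ᴴ * A s) := by
  unfold siteImage
  refine Finset.sum_congr rfl fun s _ => ?_
  rw [Finset.sum_eq_single s]
  · rw [diagonal_apply_eq]
  · intro s' _ hs'
    rw [diagonal_apply_ne _ (Ne.symm hs'), zero_smul]
  · intro h
    exact absurd (Finset.mem_univ s) h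

/-- One matrix unit at site `j < N`: `Σ_a ⟨ψ_a, E^{(j)}_{ab} ψ_a⟩ = Tr(𝔼^{N−1−j}(r r†) · (A a)ᴴ (A b))`
(left isometry collapses the `j` transfer operators to the left of the site). -/
theorem sum_star_mpsOpen_dotProduct_onSite_single_mulVec {A : MPSTensor q D}
    (hA : ∑ s, (A s)ᴴ * A s = 1) (r : Fin D → ℂ) {N j : ℕ} (hj : j < N) (a b : Fin q) :
    ∑ l : Fin D, star (mpsOpen N A (Pi.single l 1) r) ⬝ᵥ
        (onSite (⟨j, hj⟩ : Fin N) (Matrix.single a b (1 : ℂ)) *ᵥ mpsOpen N A (Pi.single l 1) r) =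
      ((transferOp A ^ (N - 1 - j)) (vecMulVec r (star r)) * ((A a)ᴴ * A b)).trace := by
  rw [onSite_eq_productOp, sum_star_mpsOpen_dotProduct_productOp_mulVec]
  set G : Fin N → Matrix (Fin q) (Fin q) ℂ :=
    Function.update (fun _ => 1) (⟨j, hj⟩ : Fin N) (Matrix.single a b 1) with hG
  have hGval : ∀ (k : ℕ) (hk : k < N), G ⟨k, hk⟩ = if k = j then Matrix.single a b 1 else 1 := by
    intro k hk
    simp only [hG, Function.update_apply, Fin.ext_iff]
  have hlist : (List.ofFn fun k : Fin N =>
      ∑ i : Fin q, ∑ i' : Fin q, G k i i' • LinearMap.mulLeftRight ℂ (A i', (A i)ᴴ)) =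
      List.replicate j (transferOp A) ++
        (LinearMap.mulLeftRight ℂ (A b, (A a)ᴴ) :: List.replicate (N - 1 - j) (transferOp A)) := by
    apply List.ext_getElem
    · simp
      omega
    · intro k h₁ h₂
      rw [List.length_ofFn] at h₁
      rw [List.getElem_ofFn, hGval k h₁, List.getElem_append]
      simp only [List.length_replicate]
      by_cases hkj : k < j
      · rw [dif_pos hkj, List.getElem_replicate, if_neg (show k ≠ j by omega), transferOpGen_one]
      · rw [dif_neg hkj]
        by_cases hk1 : k = j
        · rw [if_pos hk1, transferOpGen_single, List.getElem_cons, dif_pos (show k - j = 0 by omega)]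
        · rw [if_neg hk1, transferOpGen_one, List.getElem_cons, dif_neg (show k - j ≠ 0 by omega),
            List.getElem_replicate]
  rw [hlist, List.prod_append, List.prod_cons, List.prod_replicate, List.prod_replicate,
    Module.End.mul_apply, trace_transferOp_pow hA, Module.End.mul_apply, LinearMap.mulLeftRight_apply,
    trace_mul_cycle, trace_mul_comm]

/-- **One-site insertion.** For a left-isometric tensor, the open MPS vectors `ψ_a = mpsOpen N A e_a r`
and a one-site matrix `M` at site `j < N`: `Σ_a ⟨ψ_a, M_j ψ_a⟩ = Tr(𝔼^{N−1−j}(r r†) · Y_M)`. -/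
theorem sum_star_mpsOpen_dotProduct_onSite_mulVec {A : MPSTensor q D}
    (hA : ∑ s, (A s)ᴴ * A s = 1) (r : Fin D → ℂ) {N j : ℕ} (hj : j < N)
    (M : Matrix (Fin q) (Fin q) ℂ) :
    ∑ l : Fin D, star (mpsOpen N A (Pi.single l 1) r) ⬝ᵥ
        (onSite (⟨j, hj⟩ : Fin N) M *ᵥ mpsOpen N A (Pi.single l 1) r) =
      ((transferOp A ^ (N - 1 - j)) (vecMulVec r (star r)) * siteImage A M).trace := by
  simp only [onSite_eq_sum_single (⟨j, hj⟩ : Fin N) M, siteImage, Matrix.sum_mulVec, Matrix.smul_mulVec,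
    dotProduct_sum, dotProduct_smul, smul_eq_mul, Finset.mul_sum, Matrix.mul_smul, trace_sum,
    trace_smul]
  rw [Finset.sum_comm]
  refine Finset.sum_congr rfl fun a _ => ?_
  rw [Finset.sum_comm]
  refine Finset.sum_congr rfl fun b _ => ?_
  rw [← Finset.mul_sum, sum_star_mpsOpen_dotProduct_onSite_single_mulVec hA r hj]

/-! ### The charge identity -/

/-- One entry of `(A s)ᴴ P̂ (A s)` under the charge rule: `lab β = lab j + Q − nS s` on the support of
the column `j` of `A s`, hence `((A s)ᴴ P̂ (A s))_{ij} = (lab j + Q − nS s) · ((A s)ᴴ (A s))_{ij}`. -/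
theorem conjTranspose_mul_diagonal_mul_apply_of_charges {A : MPSTensor q D} (nS : Fin q → ℤ)
    (lab : Fin D → ℤ) (Q : ℤ) (hBC : ∀ (s : Fin q) (α β : Fin D), A s α β ≠ 0 → lab β + Q = lab α + nS s)
    (s : Fin q) (i j : Fin D) :
    ((A s)ᴴ * diagonal (fun α => ((lab α : ℤ) : ℂ)) * A s) i j =
      (((lab j : ℤ) : ℂ) + Q - nS s) * ((A s)ᴴ * A s) i j := by
  rw [Matrix.mul_apply, Matrix.mul_apply, Finset.mul_sum]
  refine Finset.sum_congr rfl fun β _ => ?_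
  rw [Matrix.mul_diagonal, Matrix.conjTranspose_apply]
  by_cases h : A s β j = 0
  · simp [h]
  · have h₁ := hBC s β j h
    have h₂ : (lab β : ℤ) = lab j + Q - nS s := by omega
    have h₃ : ((lab β : ℤ) : ℂ) = ((lab j : ℤ) : ℂ) + Q - nS s := by exact_mod_cast h₂
    rw [h₃]
    ring

/-- **`Φ(P̂)` under the charge rule**: `Φ(P̂) = P̂ + Q·1 − Σ_s nS_s (A s)ᴴ (A s)` for a left-isometric tensor. -/
theorem heisenberg_diagonal_of_charges {A : MPSTensor q D} (hA : ∑ s, (A s)ᴴ * A s = 1)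
    (nS : Fin q → ℤ) (lab : Fin D → ℤ) (Q : ℤ)
    (hBC : ∀ (s : Fin q) (α β : Fin D), A s α β ≠ 0 → lab β + Q = lab α + nS s) :
    heisenberg A (diagonal fun α => ((lab α : ℤ) : ℂ)) =
      diagonal (fun α => ((lab α : ℤ) : ℂ)) + ((Q : ℤ) : ℂ) • (1 : Matrix (Fin D) (Fin D) ℂ) -
        ∑ s, ((nS s : ℤ) : ℂ) • ((A s)ᴴ * A s) := by
  ext i j
  rw [heisenberg, Matrix.sum_apply]
  simp only [conjTranspose_mul_diagonal_mul_apply_of_charges nS lab Q hBC, sub_mul, Finset.sum_sub_distrib,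
    ← Finset.mul_sum]
  have h1 : ∑ s, ((A s)ᴴ * A s) i j = (1 : Matrix (Fin D) (Fin D) ℂ) i j := by
    rw [← Matrix.sum_apply, hA]
  rw [h1, Matrix.sub_apply, Matrix.add_apply, Matrix.sum_apply, Matrix.smul_apply, Matrix.one_apply,
    diagonal_apply]
  simp only [Matrix.smul_apply, smul_eq_mul]
  by_cases hij : i = j
  · subst hij
    simp
  · simp [hij]

/-- **The charge identity (WRITER-II-SPEC (γ)).** For a left-isometric `U(1)`-blocked tensor (charge rule
`A s α β ≠ 0 → lab β + Q = lab α + nS s`), the one-site image of the number matrix `diag nS` is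
`Y_N = P̂ + Q·1 − Φ(P̂)` with the label operator `P̂ = diag lab`. -/
theorem siteImage_charge_eq {A : MPSTensor q D} (hA : ∑ s, (A s)ᴴ * A s = 1)
    (nS : Fin q → ℤ) (lab : Fin D → ℤ) (Q : ℤ)
    (hBC : ∀ (s : Fin q) (α β : Fin D), A s α β ≠ 0 → lab β + Q = lab α + nS s) :
    siteImage A (diagonal fun s => ((nS s : ℤ) : ℂ)) =
      diagonal (fun α => ((lab α : ℤ) : ℂ)) + ((Q : ℤ) : ℂ) • (1 : Matrix (Fin D) (Fin D) ℂ) -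
        heisenberg A (diagonal fun α => ((lab α : ℤ) : ℂ)) := by
  rw [siteImage_diagonal, heisenberg_diagonal_of_charges hA nS lab Q hBC]
  abel

/-! ### Telescoping over the sites -/

/-- **The mean particle number of the uMPS mixture, telescoped.** For a left-isometric `U(1)`-blocked
tensor and `N` sites: `Σ_a ⟨ψ_a, (Σ_j N_j) ψ_a⟩ = N·Q·‖r‖² + (Tr(r r† P̂) − Tr(𝔼^N(r r†) P̂))`. -/
theorem sum_star_mpsOpen_dotProduct_sum_onSite_charge_eq {A : MPSTensor q D}
    (hA : ∑ s, (A s)ᴴ * A s = 1) (r : Fin D → ℂ) (N : ℕ) (nS : Fin q → ℤ) (lab : Fin D → ℤ) (Q : ℤ)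
    (hBC : ∀ (s : Fin q) (α β : Fin D), A s α β ≠ 0 → lab β + Q = lab α + nS s) :
    ∑ l : Fin D, star (mpsOpen N A (Pi.single l 1) r) ⬝ᵥ
        ((∑ j : Fin N, onSite j (diagonal fun s => ((nS s : ℤ) : ℂ))) *ᵥ mpsOpen N A (Pi.single l 1) r) =
      (N : ℂ) * ((Q : ℤ) : ℂ) * (star r ⬝ᵥ r) +
        ((vecMulVec r (star r) * diagonal (fun α => ((lab α : ℤ) : ℂ))).trace -
          ((transferOp A ^ N) (vecMulVec r (star r)) * diagonal (fun α => ((lab α : ℤ) : ℂ))).trace) := by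
  set P : Matrix (Fin D) (Fin D) ℂ := diagonal (fun α => ((lab α : ℤ) : ℂ)) with hP
  set σ : ℕ → Matrix (Fin D) (Fin D) ℂ := fun m => (transferOp A ^ m) (vecMulVec r (star r)) with hσ
  have hσtr : ∀ m, (σ m).trace = star r ⬝ᵥ r := fun m => by
    rw [hσ, trace_transferOp_pow hA, trace_vecMulVec, dotProduct_comm]
  have hσsucc : ∀ m, transferOp A (σ m) = σ (m + 1) := fun m => by
    rw [hσ]
    simp only
    rw [pow_succ', Module.End.mul_apply]
  -- site by site
  have hsite : ∀ j : Fin N, ∑ l : Fin D, star (mpsOpen N A (Pi.single l 1) r) ⬝ᵥ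
      (onSite j (diagonal fun s => ((nS s : ℤ) : ℂ)) *ᵥ mpsOpen N A (Pi.single l 1) r) =
      ((Q : ℤ) : ℂ) * (star r ⬝ᵥ r) + ((σ (N - 1 - j) * P).trace - (σ (N - 1 - j + 1) * P).trace) := by
    intro j
    have h := sum_star_mpsOpen_dotProduct_onSite_mulVec hA r j.isLt (diagonal fun s => ((nS s : ℤ) : ℂ))
    rw [show (⟨(j : ℕ), j.isLt⟩ : Fin N) = j from rfl] at h
    rw [h, siteImage_charge_eq hA nS lab Q hBC, Matrix.mul_sub, Matrix.mul_add, trace_sub, trace_add,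
      Matrix.mul_smul, Matrix.mul_one, trace_smul, smul_eq_mul, trace_mul_heisenberg, hσsucc, hσtr]
    ring
  simp only [Matrix.sum_mulVec, dotProduct_sum]
  rw [Finset.sum_comm]
  simp only [hsite]
  rw [Finset.sum_add_distrib, Finset.sum_const, Finset.card_univ, Fintype.card_fin, nsmul_eq_mul,
    Fin.sum_univ_eq_sum_range (fun j => (σ (N - 1 - j) * P).trace - (σ (N - 1 - j + 1) * P).trace) N]
  have hrefl : ∑ i ∈ range N, ((σ (N - 1 - i) * P).trace - (σ (N - 1 - i + 1) * P).trace) =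
      ∑ m ∈ range N, ((σ m * P).trace - (σ (m + 1) * P).trace) :=
    Finset.sum_range_reflect (fun m => (σ m * P).trace - (σ (m + 1) * P).trace) N
  rw [hrefl, Finset.sum_range_sub', hσ]
  simp only [pow_zero, Module.End.one_apply]
  ring

/-- `qmax·1 − P̂ ⪰ 0` for labels `≤ qmax`. -/
theorem posSemidef_smul_one_sub_diagonal_of_le (lab : Fin D → ℤ) {qmax : ℤ} (hmax : ∀ α, lab α ≤ qmax) :
    ((((qmax : ℤ) : ℝ) : ℂ) • (1 : Matrix (Fin D) (Fin D) ℂ) - diagonal (fun α => ((lab α : ℤ) : ℂ))).PosSemidef := by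
  rw [smul_one_eq_diagonal, diagonal_sub]
  refine posSemidef_diagonal_iff.2 fun α => ?_
  have h : (0 : ℝ) ≤ ((qmax : ℤ) : ℝ) - ((lab α : ℤ) : ℝ) := by
    have := hmax α
    have : ((lab α : ℤ) : ℝ) ≤ ((qmax : ℤ) : ℝ) := by exact_mod_cast this
    linarith
  have h' : (((qmax : ℤ) : ℝ) : ℂ) - ((lab α : ℤ) : ℂ) = (((((qmax : ℤ) : ℝ) - ((lab α : ℤ) : ℝ)) : ℝ) : ℂ) := by
    push_cast
    ring
  rw [h']
  exact Complex.zero_le_real.2 h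

/-- `(−qmin)·1 + P̂ ⪰ 0` for labels `≥ qmin`. -/
theorem posSemidef_smul_one_add_diagonal_of_le (lab : Fin D → ℤ) {qmin : ℤ} (hmin : ∀ α, qmin ≤ lab α) :
    ((((-qmin : ℤ) : ℝ) : ℂ) • (1 : Matrix (Fin D) (Fin D) ℂ) + diagonal (fun α => ((lab α : ℤ) : ℂ))).PosSemidef := by
  rw [smul_one_eq_diagonal, diagonal_add]
  refine posSemidef_diagonal_iff.2 fun α => ?_
  have h : (0 : ℝ) ≤ ((-qmin : ℤ) : ℝ) + ((lab α : ℤ) : ℝ) := by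
    have := hmin α
    have : ((qmin : ℤ) : ℝ) ≤ ((lab α : ℤ) : ℝ) := by exact_mod_cast this
    push_cast
    linarith
  have h' : (((-qmin : ℤ) : ℝ) : ℂ) + ((lab α : ℤ) : ℂ) = (((((-qmin : ℤ) : ℝ) + ((lab α : ℤ) : ℝ)) : ℝ) : ℂ) := by
    push_cast
    ring
  rw [h']
  exact Complex.zero_le_real.2 h

/-- `qmin ≤ Re Tr(σ P̂) ≤ qmax` for a density matrix `σ` (`σ ⪰ 0`, `Re Tr σ = 1`) and labels in `[qmin, qmax]`. -/
theorem re_trace_mul_diagonal_mem {σ : Matrix (Fin D) (Fin D) ℂ} (hσ : σ.PosSemidef) (hσ1 : σ.trace.re = 1)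
    (lab : Fin D → ℤ) {qmin qmax : ℤ} (hlab : ∀ α, qmin ≤ lab α ∧ lab α ≤ qmax) :
    ((qmin : ℤ) : ℝ) ≤ (σ * diagonal (fun α => ((lab α : ℤ) : ℂ))).trace.re ∧
      (σ * diagonal (fun α => ((lab α : ℤ) : ℂ))).trace.re ≤ ((qmax : ℤ) : ℝ) := by
  constructor
  · have h := neg_re_trace_mul_le_of_posSemidef_add hσ
      (posSemidef_smul_one_add_diagonal_of_le lab fun α => (hlab α).1)
    rw [hσ1, mul_one] at h
    push_cast at h
    linarith
  · have h := re_trace_mul_le_of_posSemidef_sub hσ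
      (posSemidef_smul_one_sub_diagonal_of_le lab fun α => (hlab α).2)
    rw [hσ1, mul_one] at h
    exact h

/-- **The k-free number defect (WRITER-II-SPEC (γ)).** For a left-isometric `U(1)`-blocked tensor with cell
charge `Q`, labels in `[qmin, qmax]` on the bond space and a unit boundary vector, the mean particle number of
the mixture `Σ_a |ψ_a⟩⟨ψ_a|` on `N` sites is `N·Q` up to `qmax − qmin`, uniformly in `N`:
`N·Q − (qmax − qmin) ≤ Re Σ_a ⟨ψ_a, (Σ_j N_j) ψ_a⟩ ≤ N·Q + (qmax − qmin)`. -/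
theorem re_sum_star_mpsOpen_dotProduct_sum_onSite_charge_mem {A : MPSTensor q D}
    (hA : ∑ s, (A s)ᴴ * A s = 1) {r : Fin D → ℂ} (hr : star r ⬝ᵥ r = 1) (N : ℕ) (nS : Fin q → ℤ)
    (lab : Fin D → ℤ) (Q : ℤ) (hBC : ∀ (s : Fin q) (α β : Fin D), A s α β ≠ 0 → lab β + Q = lab α + nS s)
    {qmin qmax : ℤ} (hlab : ∀ α, qmin ≤ lab α ∧ lab α ≤ qmax) :
    (N : ℝ) * ((Q : ℤ) : ℝ) - (((qmax : ℤ) : ℝ) - ((qmin : ℤ) : ℝ)) ≤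
        (∑ l : Fin D, star (mpsOpen N A (Pi.single l 1) r) ⬝ᵥ
          ((∑ j : Fin N, onSite j (diagonal fun s => ((nS s : ℤ) : ℂ))) *ᵥ mpsOpen N A (Pi.single l 1) r)).re ∧
      (∑ l : Fin D, star (mpsOpen N A (Pi.single l 1) r) ⬝ᵥ
          ((∑ j : Fin N, onSite j (diagonal fun s => ((nS s : ℤ) : ℂ))) *ᵥ mpsOpen N A (Pi.single l 1) r)).re ≤
        (N : ℝ) * ((Q : ℤ) : ℝ) + (((qmax : ℤ) : ℝ) - ((qmin : ℤ) : ℝ)) := by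
  rw [sum_star_mpsOpen_dotProduct_sum_onSite_charge_eq hA r N nS lab Q hBC, hr, mul_one, Complex.add_re,
    Complex.sub_re]
  have hN : ((N : ℂ) * ((Q : ℤ) : ℂ)).re = (N : ℝ) * ((Q : ℤ) : ℝ) := by
    rw [← Complex.ofReal_natCast, ← Complex.ofReal_intCast, ← Complex.ofReal_mul, Complex.ofReal_re]
  rw [hN]
  have h0 := re_trace_mul_diagonal_mem (posSemidef_vecMulVec_self_star r)
    (by rw [trace_vecMulVec, dotProduct_comm, hr, Complex.one_re]) lab hlab
  have h1 := re_trace_mul_diagonal_mem (transferOp_pow_posSemidef A N (posSemidef_vecMulVec_self_star r))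
    (by rw [trace_transferOp_pow hA, trace_vecMulVec, dotProduct_comm, hr, Complex.one_re]) lab hlab
  constructor <;> linarith [h0.1, h0.2, h1.1, h1.2]

end Summit.Ventures.CertifiedManyBodySolver.Upper

end
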